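import Summits.CriticalPhenomena.PercolationContinuityZ3.Theorems.PercNearOneGluingNoHeavyQuantHullHigh
import Summits.CriticalPhenomena.PercolationContinuityZ3.Theorems.PercNearOneGluingNoHeavyQuantBudgetNearFlow
import HarnessLib

/-!
# QUANT lane R8, T-DEC: SUB-FLOOR HUBS (part 1, the PAIR HUB) — two far-giant pieces `{1,3;γᵢ}` convolved are SDEC at the true floor although
# each one alone violates the FAR row (the cores of the piece expansion of the node's residue: three glued children `R[qᵢ](R²[gᵢ])`)

builds on p205010 (kernel theorem, internal audit signed; external expert review pending)

Support file (`--supports stmt-CriticalPhenomena-4575`), QUANT lane seat prim-quant-census-1 (gen 30); memo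
`run/shared/lean/prim/quant/prim-quant-census-1/g30/SUBFLOOR-HUBS-G30.md`.  Theorems only (standard axioms, no sorries) over the lane's
flow criteria: arm-1 g49's `decAt_all_of_budget_near` / `decAt_all_of_lowCeiling` (`…QuantBudgetNearFlow`, `…QuantLowCeiling`).

THE SETTING (RATE-PLAN §58.4).  After COMP-SLICE (✓ p547225) and HIGH-CONV (✓ p548056) the sibling step `SiblingStep` owes only forests ALL of
whose siblings are heavy-unfloored; the smallest such sibling is the glued child `R[q](R²[g])` of mean `m = q(1+2g) > 2` at floors
`(m−1)/2 < x < qg`, whose gated law `(1−q, q(1−g), 0, qg)` is the (forced) same-mean mixture of the heavy blob `blob₃(m/3)` and the FAR-GIANT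
PIECE `C(γ) = {1,3;γ}`, `γ = (m−1)/2 < x` (a sure relay over an UNDER-floor 2-blob; not SDEC at `x`: the FAR row `P(N ≥ 3) = γ < x` fails).
Expanding a forest of glued children over the per-sibling choices gives terms `C_S ∗ blob_{Sᶜ}`; the heavy blobs peel off
(`sdec_lconv_blobLaw`), so the new cores are the SUB-FLOOR HUBS `∗_{i∈S} C(γᵢ)` = `|S|` sure relays ⊕ `|S|` independent under-floor 2-blobs.
This file proves that the pair hub and the triple hub ARE SDEC at `x` on the whole closure of the glued-child parameter region
(`1/2 ≤ γᵢ < 1`, `3x ≤ 1 + 2γᵢ`; for a glued child `1 + 2γᵢ = mᵢ` and `x ≤ qᵢgᵢ ≤ mᵢ/3`):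
* **`sdec_pairHub`**: `C(γ₁) ∗ C(γ₂) = {2: (1−γ₁)(1−γ₂), 4: γ₁(1−γ₂)+(1−γ₁)γ₂, 6: γ₁γ₂}` is `SDEC x 6`.  Certificate: after the outer gate `a`
  the only positive low atom is `2` (when `T = a(2+2γ₁+2γ₂) > 4`), shipped by ONE NEAR ROUTE `2 → 4` ("one more blob on") at the layer-free rate
  `max(ax, (T−4)/2)/(1 − max(…))`; capacity ⟸ `x·(e₀+e₁) ≤ e₁` (termwise from `3x ≤ 1+2γᵢ`, `γᵢ ≥ 1/2`) and `(γ₁+γ₂−1)(e₀+e₁) ≤ e₁`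
  (`= (1−γ₁)(1−γ₂)(1+γ₁+γ₂) + (γ₁−γ₂)² ≥ 0`); the zero atom rides the torque (`decAt_all_of_budget_near` with no leftover).
* **`sdec_tripleHub`**: `C(γ₁) ∗ C(γ₂) ∗ C(γ₃)` on `{3,5,7,9}` is `SDEC x 9`: the only positive low `3` (when `T > 6`) goes to `5` while `T < 7`
  and to `7` when `T ≥ 7` (both near routes); capacities ⟸ `x(e₀+e₁) ≤ e₁`, `e₀ ≤ e₁`, `x(e₀+e₂) ≤ e₂`, `3e₀ ≤ e₂` (termwise).
EVIDENCE BEHIND THE SHAPE (memo §2–§4, exact rational LPs): for relay ⊕ independent-blob hubs SDEC ⟺ the FAR rows of the UNGATED hub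
(`P(N ≥ j+1) ≥ x` for `2j < mean`) ⟺ arm-1 g50's layer-free torque-cost LP is feasible at every gate — 0 exceptions in ≈ 10 000 hubs incl. ≈ 800
non-SDEC ones (conjecture HUB-FAR of the memo; false for general laws, e.g. census-2 g53's `{1:36/73, 2:1/73, 6:36/73}`).

HONEST STATUS.  Two cores of the width-3 glued-children instance; the third core (`C(γ) ∗ blob₃(g')`, one far-giant piece beside a big heavy blob)
and the assembly are owed (memo §5).  `SiblingStep` ⟺ `GateStepN`, `FarTreeRow` OPEN; RATE class (log\*) / honest sentence of
`run/shared/lean/prim/quant/README.md` unchanged.  [this work].  Nothing here is cited as a published result.  The gluing rows served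
[cite: KozmaNitzan2024, Conjecture 3 (p. 15)]; product measure [cite: Grimmett1999, §1.3 p. 10].
-/

noncomputable section

open scoped BigOperators

namespace Summit.CriticalPhenomena.PercolationContinuityZ3.Theorems
namespace Quant
namespace LawDec

open Finset

/-- the FAR-GIANT PIECE `C(γ) = {1, 3; γ}`: one sure relay over an under-floor 2-blob at gate `γ` -/
local notation3 "CP[" a "]" => (fun h : ℕ => (1 - (a : ℝ)) * (if h = 1 then (1 : ℝ) else 0) + (a : ℝ) * (if h = 3 then (1 : ℝ) else 0))

/-- the PAIR HUB `C(γ₁) ∗ C(γ₂)`: two sure relays ⊕ two independent 2-blobs at gates `γ₁`, `γ₂` -/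
local notation3 "PH[" a ", " b "]" => (fun h : ℕ =>
  (1 - (a : ℝ)) * (1 - (b : ℝ)) * (if h = 2 then (1 : ℝ) else 0) +
  ((a : ℝ) * (1 - (b : ℝ)) + (1 - (a : ℝ)) * (b : ℝ)) * (if h = 4 then (1 : ℝ) else 0) +
  (a : ℝ) * (b : ℝ) * (if h = 6 then (1 : ℝ) else 0))

/-! ### The laws as convolutions of far-giant pieces -/

/-- the far-giant piece is the gated glued pair under a sure relay: `C(γ) = δ₁ ∗ gate δ₂ γ`. [this work] -/
theorem farPiece_eq_lconv (γ : ℝ) :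
    lconv 1 2 (fun h : ℕ => if h = 1 then (1 : ℝ) else 0) (gate (fun h : ℕ => if h = 2 then (1 : ℝ) else 0) γ) = CP[γ] := by
  funext h
  simp only [lconv, Finset.sum_range_succ, Finset.sum_range_zero, gate_apply]
  rcases Nat.lt_or_ge h 7 with hh | hh
  · interval_cases h
    all_goals norm_num
  · simp [show h ≠ 1 by omega, show h ≠ 3 by omega, show (1 : ℕ) ≠ h by omega, show (3 : ℕ) ≠ h by omega]

/-- the pair hub is the convolution of two far-giant pieces. [this work] -/
theorem pairHub_eq_lconv (γ₁ γ₂ : ℝ) : lconv 3 3 CP[γ₁] CP[γ₂] = PH[γ₁, γ₂] := by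
  funext h
  simp only [lconv, Finset.sum_range_succ, Finset.sum_range_zero]
  rcases Nat.lt_or_ge h 7 with hh | hh
  · interval_cases h
    all_goals norm_num
    all_goals ring
  · simp [show h ≠ 2 by omega, show h ≠ 4 by omega, show h ≠ 6 by omega, show (2 : ℕ) ≠ h by omega,
      show (4 : ℕ) ≠ h by omega, show (6 : ℕ) ≠ h by omega]

/-! ### One algebraic step: a layer-free rate against a capacity -/

/-- capacity of one route: `θ < 1`, `θ·(A + B) ≤ B`, `A ≥ 0` ⟹ `θ/(1−θ)·A ≤ B`. [this work] -/
theorem rate_mul_le_of_theta {θ A B : ℝ} (hθ1 : θ < 1) (h : θ * (A + B) ≤ B) (_hA : 0 ≤ A) : θ / (1 - θ) * A ≤ B := by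
  rw [div_mul_eq_mul_div, div_le_iff₀ (by linarith)]
  linarith

/-- the per-blob inequality behind the pair hub: `3x ≤ 1 + 2γ`, `1/2 ≤ γ ≤ 1` ⟹ `x(1−γ) ≤ 2(1−x)γ`
(`2γ − x(1+γ) = (1+γ)(1+2γ−3x)/3 + (2γ−1)(1−γ)/3`). [this work] -/
theorem pairHub_blob_ineq {x γ : ℝ} (hγ : 1 / 2 ≤ γ) (hγ1 : γ ≤ 1) (hx : 3 * x ≤ 1 + 2 * γ) : x * (1 - γ) ≤ 2 * (1 - x) * γ := by
  nlinarith [mul_nonneg (show (0 : ℝ) ≤ 1 + γ by linarith) (show (0 : ℝ) ≤ 1 + 2 * γ - 3 * x by linarith),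
    mul_nonneg (show (0 : ℝ) ≤ 2 * γ - 1 by linarith) (show (0 : ℝ) ≤ 1 - γ by linarith)]

/-- first capacity inequality of the pair hub: `x·(e₀ + e₁) ≤ e₁`. [this work] -/
theorem pairHub_key1 {x γ₁ γ₂ : ℝ} (h₁ : 1 / 2 ≤ γ₁) (h₁' : γ₁ ≤ 1) (h₂ : 1 / 2 ≤ γ₂) (h₂' : γ₂ ≤ 1)
    (hx₁ : 3 * x ≤ 1 + 2 * γ₁) (hx₂ : 3 * x ≤ 1 + 2 * γ₂) :
    x * ((1 - γ₁) * (1 - γ₂) + (γ₁ * (1 - γ₂) + (1 - γ₁) * γ₂)) ≤ γ₁ * (1 - γ₂) + (1 - γ₁) * γ₂ := by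
  have s₁ : 0 ≤ 2 * (1 - x) * γ₁ - x * (1 - γ₁) := by linarith [pairHub_blob_ineq h₁ h₁' hx₁]
  have s₂ : 0 ≤ 2 * (1 - x) * γ₂ - x * (1 - γ₂) := by linarith [pairHub_blob_ineq h₂ h₂' hx₂]
  nlinarith [mul_nonneg (show (0 : ℝ) ≤ 1 - γ₂ by linarith) s₁, mul_nonneg (show (0 : ℝ) ≤ 1 - γ₁ by linarith) s₂]

/-- second capacity inequality of the pair hub: `(γ₁+γ₂−1)·(e₀ + e₁) ≤ e₁`
(`e₁ − (γ₁+γ₂−1)(e₀+e₁) = (1−γ₁)(1−γ₂)(1+γ₁+γ₂) + (γ₁−γ₂)²`). [this work] -/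
theorem pairHub_key2 {γ₁ γ₂ : ℝ} (h₁' : γ₁ ≤ 1) (h₂' : γ₂ ≤ 1) (h₁ : 0 ≤ γ₁) (h₂ : 0 ≤ γ₂) :
    (γ₁ + γ₂ - 1) * ((1 - γ₁) * (1 - γ₂) + (γ₁ * (1 - γ₂) + (1 - γ₁) * γ₂)) ≤ γ₁ * (1 - γ₂) + (1 - γ₁) * γ₂ := by
  nlinarith [mul_nonneg (mul_nonneg (show (0 : ℝ) ≤ 1 - γ₁ by linarith) (show (0 : ℝ) ≤ 1 - γ₂ by linarith))
    (show (0 : ℝ) ≤ 1 + γ₁ + γ₂ by linarith), sq_nonneg (γ₁ - γ₂)]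

/-- **THE PAIR HUB IS SDEC.** [this work] -/
theorem sdec_pairHub {x γ₁ γ₂ : ℝ} (hx0 : 0 < x) (hx1 : x < 1) (h₁ : 1 / 2 ≤ γ₁) (h₁' : γ₁ < 1) (h₂ : 1 / 2 ≤ γ₂) (h₂' : γ₂ < 1)
    (hx₁ : 3 * x ≤ 1 + 2 * γ₁) (hx₂ : 3 * x ≤ 1 + 2 * γ₂) : SDEC x 6 PH[γ₁, γ₂] := by
  have a0 : 0 ≤ (1 - γ₁) * (1 - γ₂) := mul_nonneg (by linarith) (by linarith)
  have b0 : 0 ≤ γ₁ * (1 - γ₂) + (1 - γ₁) * γ₂ :=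
    add_nonneg (mul_nonneg (by linarith) (by linarith)) (mul_nonneg (by linarith) (by linarith))
  have c0 : 0 ≤ γ₁ * γ₂ := mul_nonneg (by linarith) (by linarith)
  -- law facts
  have l0 : ∀ h, 0 ≤ PH[γ₁, γ₂] h := by
    intro h; dsimp only
    split_ifs <;> linarith
  have lM : ∀ h, 6 < h → PH[γ₁, γ₂] h = 0 := by
    intro h hh; dsimp only; rw [if_neg (by omega), if_neg (by omega), if_neg (by omega)]; ring
  have l1 : ∑ h ∈ Finset.range (6 + 1), PH[γ₁, γ₂] h = 1 := by
    simp [Finset.sum_range_succ]; ring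
  have lmean : ∑ h ∈ Finset.range (6 + 1), (h : ℝ) * PH[γ₁, γ₂] h = 2 + 2 * γ₁ + 2 * γ₂ := by
    simp [Finset.sum_range_succ]; ring
  have key1 := pairHub_key1 h₁ h₁'.le h₂ h₂'.le hx₁ hx₂
  have key2 := pairHub_key2 h₁'.le h₂'.le (by linarith) (by linarith)
  have h6x : 6 * x ≤ 2 + 2 * γ₁ + 2 * γ₂ := by linarith
  intro a ha0 ha1 j' hj'
  obtain ⟨g0, gM, g1⟩ := gate_laws 6 PH[γ₁, γ₂] a ha0.le ha1 l0 lM l1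
  have gmean : ∑ h ∈ Finset.range (6 + 1), (h : ℝ) * gate PH[γ₁, γ₂] a h = a * (2 + 2 * γ₁ + 2 * γ₂) := by
    rw [sum_mul_gate, lmean]
  set T : ℝ := a * (2 + 2 * γ₁ + 2 * γ₂) with hT
  have hax0 : 0 < a * x := mul_pos ha0 hx0
  have hax1 : a * x < 1 := by
    have := mul_le_mul_of_nonneg_right ha1 hx0.le
    linarith
  have haxx : a * x ≤ x := by
    have := mul_le_mul_of_nonneg_right ha1 hx0.le
    linarith
  have hT0 : 0 < T := by rw [hT]; positivity
  have hTle : T ≤ 2 + 2 * γ₁ + 2 * γ₂ := by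
    have := mul_le_mul_of_nonneg_right ha1 (show (0 : ℝ) ≤ 2 + 2 * γ₁ + 2 * γ₂ by linarith)
    linarith
  have hT6 : T < 6 := by linarith
  have hta : a * x * ((6 : ℕ) : ℝ) ≤ T := by
    have := mul_le_mul_of_nonneg_left h6x ha0.le
    push_cast; linarith
  have v1 : gate PH[γ₁, γ₂] a 1 = 0 := by rw [gate_apply]; norm_num
  have v2 : gate PH[γ₁, γ₂] a 2 = a * ((1 - γ₁) * (1 - γ₂)) := by rw [gate_apply]; norm_num
  have v4 : gate PH[γ₁, γ₂] a 4 = a * (γ₁ * (1 - γ₂) + (1 - γ₁) * γ₂) := by rw [gate_apply]; norm_num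
  by_cases hT4 : 4 < T
  · -- one near route `2 → 4`
    have hθ1 : max (a * x) ((T - 4) / 2) < 1 := max_lt hax1 (by linarith)
    have hθcap : max (a * x) ((T - 4) / 2) * (gate PH[γ₁, γ₂] a 2 + gate PH[γ₁, γ₂] a 4) ≤ gate PH[γ₁, γ₂] a 4 := by
      rw [v2, v4]
      have e0 : 0 ≤ (1 - γ₁) * (1 - γ₂) + (γ₁ * (1 - γ₂) + (1 - γ₁) * γ₂) := by linarith
      rcases le_total (a * x) ((T - 4) / 2) with hle | hle
      · rw [max_eq_right hle]
        have hb : (T - 4) / 2 ≤ γ₁ + γ₂ - 1 := by linarith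
        have h1 := mul_le_mul_of_nonneg_right hb e0
        have h2 := mul_le_mul_of_nonneg_left (h1.trans key2) ha0.le
        have e : (T - 4) / 2 * (a * ((1 - γ₁) * (1 - γ₂)) + a * (γ₁ * (1 - γ₂) + (1 - γ₁) * γ₂))
            = a * ((T - 4) / 2 * ((1 - γ₁) * (1 - γ₂) + (γ₁ * (1 - γ₂) + (1 - γ₁) * γ₂))) := by ring
        rw [e]; exact h2
      · rw [max_eq_left hle]
        have h1 := mul_le_mul_of_nonneg_right haxx e0
        have h2 := mul_le_mul_of_nonneg_left (h1.trans key1) ha0.le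
        have e : a * x * (a * ((1 - γ₁) * (1 - γ₂)) + a * (γ₁ * (1 - γ₂) + (1 - γ₁) * γ₂))
            = a * (a * x * ((1 - γ₁) * (1 - γ₂) + (γ₁ * (1 - γ₂) + (1 - γ₁) * γ₂))) := by ring
        rw [e]; exact h2
    have eθ : (T - 2 * ((2 : ℕ) : ℝ)) / (((4 : ℕ) : ℝ) - ((2 : ℕ) : ℝ)) = (T - 4) / 2 := by norm_num
    refine decAt_all_of_budget_near (a * x) 6 6 (gate PH[γ₁, γ₂] a)
      (fun l h => if l = 2 ∧ h = 4 then gate PH[γ₁, γ₂] a 2 else 0) T hax0 hax1 g0 gM g1 gmean hT0 hta ?_ ?_ ?_ ?_ ?_ ?_ j' hj'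
    · -- nonnegativity of the transport
      intro l h; split_ifs
      · exact g0 2
      · exact le_rfl
    · -- support of the transport
      intro l h hlh
      split_ifs at hlh with hc
      · obtain ⟨rfl, rfl⟩ := hc
        refine ⟨by norm_num, by push_cast; linarith, by norm_num, by norm_num, by push_cast; linarith, by push_cast; linarith⟩
      · exact absurd hlh (lt_irrefl _)
    · -- rows
      intro l
      by_cases hl : l = 2
      · subst hl; simp
      · rw [Finset.sum_eq_zero (fun h _ => by simp [hl])]; exact g0 l
    · -- capacities
      intro h
      by_cases hh : h = 4
      · subst hh
        rw [Finset.sum_eq_single_of_mem 2 (by simp) (fun l _ hl => by simp [hl]), eθ]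
        simp only [true_and, if_true]
        exact rate_mul_le_of_theta hθ1 hθcap (g0 2)
      · rw [Finset.sum_eq_zero (fun l _ => by simp [hh])]
        exact g0 h
    · -- no leftover: the far band is not used
      intro l hl hlow hlt
      exfalso
      have hl3 : l < 3 := by
        have : (l : ℝ) < 3 := by linarith
        exact_mod_cast this
      interval_cases l
      · rw [v1, Finset.sum_eq_zero (fun h _ => by simp)] at hlt; exact lt_irrefl _ hlt
      · have e : ∑ h ∈ Finset.range (6 + 1), (if 2 = 2 ∧ h = 4 then gate PH[γ₁, γ₂] a 2 else 0) = gate PH[γ₁, γ₂] a 2 := by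
          simp
        rw [e] at hlt; exact lt_irrefl _ hlt
    · -- budget: nothing is owed
      have hL : ∑ l ∈ Finset.range (6 + 1), (if (1 ≤ l ∧ 2 * (l : ℝ) < T) then
          (gate PH[γ₁, γ₂] a l - ∑ h ∈ Finset.range (6 + 1), (if l = 2 ∧ h = 4 then gate PH[γ₁, γ₂] a 2 else 0)) * (T - l)
          else 0) = 0 := by
        refine Finset.sum_eq_zero fun l _ => ?_
        split_ifs with hc
        · have hl3 : l < 3 := by
            have : (l : ℝ) < 3 := by linarith [hc.2]
            exact_mod_cast this
          have hl1 := hc.1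
          interval_cases l
          · rw [v1, Finset.sum_eq_zero (fun h _ => by simp)]; ring
          · have e : ∑ h ∈ Finset.range (6 + 1), (if 2 = 2 ∧ h = 4 then gate PH[γ₁, γ₂] a 2 else 0) = gate PH[γ₁, γ₂] a 2 := by
              simp
            rw [e]; ring
        · rfl
      rw [hL]
      exact Finset.sum_nonneg fun h _ => by
        split_ifs with hc
        · exact mul_nonneg (g0 h) (by linarith [hc.1])
        · exact le_rfl
  · -- no positive low atom: the low-ceiling criterion is vacuous
    refine decAt_all_of_lowCeiling (a * x) 6 (gate PH[γ₁, γ₂] a) T hax0 hax1 g0 gM g1 gmean hT0 hta ?_ j' hj'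
    intro l hl hlow hpos
    exfalso
    have hl2 : l < 2 := by
      have : (l : ℝ) < 2 := by linarith
      exact_mod_cast this
    interval_cases l
    rw [v1] at hpos; exact lt_irrefl _ hpos

/-! ### Readings for glued children `R[q](R²[g])` (`m = q(1+2g) ≥ 2`, floor `x ≤ q·g`; `γ = (m−1)/2`) -/

/-- the far-giant piece of a glued child `R[q](R²[g])` with `m = q(1+2g) ∈ [2, 3)` at a floor `x ≤ qg` has `1/2 ≤ γ < 1` and `3x ≤ 1 + 2γ`
(`γ = (m−1)/2`; `3qg ≤ q + 2qg = m`). [this work] -/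
theorem gluedChild_piece_facts {x q g : ℝ} (hq0 : 0 < q) (hq1 : q < 1) (hg0 : 0 < g) (hg1 : g < 1) (hm : 2 ≤ q * (1 + 2 * g))
    (hx : x ≤ q * g) :
    1 / 2 ≤ (q * (1 + 2 * g) - 1) / 2 ∧ (q * (1 + 2 * g) - 1) / 2 < 1 ∧ 3 * x ≤ 1 + 2 * ((q * (1 + 2 * g) - 1) / 2) ∧ x < 1 := by
  have h1 : q * (1 + 2 * g) < 1 + 2 * g := by nlinarith
  have h2 : q * g ≤ q := by nlinarith
  have h3 : q * g < 1 := by nlinarith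
  refine ⟨by linarith, by linarith, by linarith, by linarith⟩

/-- **TWO GLUED CHILDREN: the sub-floor core `C(γ₁) ∗ C(γ₂)` of the piece expansion is SDEC at every floor `x ≤ min qᵢgᵢ`** (`mᵢ = qᵢ(1+2gᵢ) ≥ 2`). [this work] -/
theorem sdec_pairHub_glued {x q₁ g₁ q₂ g₂ : ℝ} (hx0 : 0 < x) (hq₁ : 0 < q₁) (hq₁' : q₁ < 1) (hg₁ : 0 < g₁) (hg₁' : g₁ < 1)
    (hq₂ : 0 < q₂) (hq₂' : q₂ < 1) (hg₂ : 0 < g₂) (hg₂' : g₂ < 1) (hm₁ : 2 ≤ q₁ * (1 + 2 * g₁)) (hm₂ : 2 ≤ q₂ * (1 + 2 * g₂))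
    (hx₁ : x ≤ q₁ * g₁) (hx₂ : x ≤ q₂ * g₂) :
    SDEC x 6 (lconv 3 3 CP[(q₁ * (1 + 2 * g₁) - 1) / 2] CP[(q₂ * (1 + 2 * g₂) - 1) / 2]) := by
  obtain ⟨a1, a2, a3, a4⟩ := gluedChild_piece_facts hq₁ hq₁' hg₁ hg₁' hm₁ hx₁
  obtain ⟨b1, b2, b3, _⟩ := gluedChild_piece_facts hq₂ hq₂' hg₂ hg₂' hm₂ hx₂
  rw [pairHub_eq_lconv]
  exact sdec_pairHub hx0 a4 a1 a2 b1 b2 a3 b3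

end LawDec
end Quant
end Summit.CriticalPhenomena.PercolationContinuityZ3.Theorems
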